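import Literature.NumberTheory.DiophantineGeometry.MultiplicativeGroupApproximationProofs
import HarnessLib

/-!
# Evertse–Győry, Theorem 4.2.1 over `ℚ`: the Liouville regime (Case B), unconditionally

Topic `NumberTheory/DiophantineGeometry`; namespace
`Literature.NumberTheory.DiophantineGeometry.Dioph`.
Companion of `MultiplicativeGroupApproximation.lean`, which vendors Evertse–Győry,
*Unit Equations in Diophantine Number Theory* (2015), Theorem 4.2.1 for `K = ℚ` as the named
fact `evertseGyory_thm_4_2_1_rat`.

The printed proof (§4.4.2, pp. 80–81) splits according to the size of `B = c₁₇ h(ξ)` against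
`2e (3d)^{2n} Θ H`. In **Case B** (`h(ξ)` small against `Θ H`) the conclusion (4.2.1) follows from
the Liouville-type inequality `log |1 − αξ|_v ≥ −log 2 − h(αξ) ≥ −log 2 − H − h(ξ)` (the
product-formula display on p. 81) and bookkeeping of constants; no linear forms in logarithms are
needed. This file PROVES that case outright for `K = ℚ`
(`evertseGyory_thm_4_2_1_rat_caseB`): inequality (4.2.1) holds at every place of `ℚ` for every
`ξ = ζ ξ₁^{b₁} ⋯ ξ_m^{b_m}` with `h(ξ) < 2e · 9^{m+1} · Θ · H` (the threshold of the printed Case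
B for `d = 1`, `n = m + 1`, with `Θ` in place of the smaller `Θ'` of a height-minimal system).
The complementary Case A is exactly where the printed proof invokes Theorem 3.2.8 (Matveev 2000
at the infinite place, Yu 2007 at the primes); see
`MultiplicativeGroupApproximationReductionProofs.lean` and
`MultiplicativeGroupApproximationThm328Proofs.lean` for that (conditional) half. No named fact is
introduced here.

## References

* [EvertseGyory2015] J.-H. Evertse, K. Győry, *Unit Equations in Diophantine Number Theory*,
  Cambridge Stud. Adv. Math. 146, CUP 2015, doi:10.1017/CBO9781316160749 — Thm 4.2.1 (p. 68),
  proof of Thm 4.2.1, Case B and the Liouville display (p. 81).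
-/

open Height Real Finset

noncomputable section

namespace Literature.NumberTheory.DiophantineGeometry.Dioph

/-- **Evertse–Győry, Theorem 4.2.1 for `K = ℚ`, Case B (the Liouville regime), proved.**
Let `ξ₁, …, ξ_m ∈ ℚ* ∖ {±1}` (`m ≥ 1`), `α, ζ ∈ ℚ`, `b ∈ ℤ^m`, `ξ := ζ ∏ ξᵢ^{bᵢ}` with
`αξ ≠ 1`, `Θ := ∏ h(ξᵢ)`, `H := max(h(α), 1)`. If `h(ξ) < 2e · 9^{m+1} · Θ · H`, then
`log |1 − αξ| > −c₈(m) (2/log 2) Θ H log*(2 h(ξ)/H)` and, for every prime `p`,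
`−ord_p(1 − αξ) log p > −c₈(m) (p/log p) Θ H log*(p h(ξ)/H)` — i.e. the conclusion of
`evertseGyory_thm_4_2_1_rat` — by `log |1 − αξ|_v ≥ −(log 2 + h(αξ)) ≥ −(log 2 + H + h(ξ))`
(`liouville_infinite`, `liouville_finite`, `logHeight₁_mul_le`) and `eg421_caseB_bound`
(`Θ ≥ (log 2)^m` by Proposition 3.2.9 for `d = 1`, `N(v)/log N(v) ≥ e`, `log* ≥ 1`). The
hypotheses `α ≠ 0`, `ζ = ±1` of the fact are not needed in this regime.
[cite: EvertseGyory2015, proof of Thm 4.2.1, Case B (p. 81)] -/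
theorem evertseGyory_thm_4_2_1_rat_caseB (ι : Type) [Fintype ι] (hι : 0 < Fintype.card ι)
    (ξ : ι → ℚ) (hξ : ∀ i, ξ i ≠ 0 ∧ ξ i ≠ 1 ∧ ξ i ≠ -1) (α ζ : ℚ) (b : ι → ℤ)
    (hne : α * (ζ * ∏ i, ξ i ^ b i) ≠ 1)
    (hsmall : logHeight₁ (ζ * ∏ i, ξ i ^ b i) <
      2 * Real.exp 1 * 9 ^ (Fintype.card ι + 1) * (∏ i, logHeight₁ (ξ i)) *
        max (logHeight₁ α) 1) :
    (-(egC8 (Fintype.card ι) * (2 / Real.log 2) * (∏ i, logHeight₁ (ξ i)) *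
          max (logHeight₁ α) 1 *
          logStar (2 * logHeight₁ (ζ * ∏ i, ξ i ^ b i) / max (logHeight₁ α) 1)) <
        Real.log |((1 - α * (ζ * ∏ i, ξ i ^ b i) : ℚ) : ℝ)|) ∧
    ∀ p : ℕ, p.Prime →
      -(egC8 (Fintype.card ι) * (p / Real.log p) * (∏ i, logHeight₁ (ξ i)) *
          max (logHeight₁ α) 1 *
          logStar (p * logHeight₁ (ζ * ∏ i, ξ i ^ b i) / max (logHeight₁ α) 1)) <
        -(padicValRat p (1 - α * (ζ * ∏ i, ξ i ^ b i)) : ℝ) * Real.log p := by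
  set m := Fintype.card ι with hm
  have hm1 : 1 ≤ m := hι
  set x : ℚ := ζ * ∏ i, ξ i ^ b i with hx
  set Θ := ∏ i, logHeight₁ (ξ i) with hΘ
  set H := max (logHeight₁ α) 1 with hH
  have hH1 : 1 ≤ H := le_max_right _ _
  have hlog2 : 0 < Real.log 2 := Real.log_pos one_lt_two
  -- (4.4.20) for `d = 1`: `Θ ≥ (log 2)^m` (Proposition 3.2.9 with `d = 1`)
  have hΘlow : Real.log 2 ^ m ≤ Θ := by
    have : ∏ _i : ι, Real.log 2 = Real.log 2 ^ m := by rw [Finset.prod_const, Finset.card_univ]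
    rw [← this]
    exact Finset.prod_le_prod (fun i _ => hlog2.le) fun i _ =>
      log_two_le_logHeight₁ (hξ i).1 (hξ i).2.1 (hξ i).2.2
  -- `N(v)/log N(v) ≥ e`
  have hk2 : Real.exp 1 ≤ 2 / Real.log 2 := exp_one_le_div_log one_lt_two
  have hkp : ∀ p : ℕ, p.Prime → Real.exp 1 ≤ p / Real.log p := fun p hp =>
    exp_one_le_div_log (by exact_mod_cast hp.one_lt)
  -- `h(αξ) ≤ H + h(ξ)`, hence `log 2 + h(αξ) < log 2 + H + 2e 9^{m+1} Θ H`
  have hhy : logHeight₁ (α * x) ≤ H + logHeight₁ x :=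
    le_trans (logHeight₁_mul_le α x) (by linarith [le_max_left (logHeight₁ α) 1])
  have ht : Real.log 2 + logHeight₁ (α * x) <
      Real.log 2 + H + 2 * Real.exp 1 * 9 ^ (m + 1) * Θ * H := by linarith
  refine ⟨?_, fun p hp => ?_⟩
  · have h1 := liouville_infinite hne
    have h2 := eg421_caseB_bound m hm1 (k := 2 / Real.log 2)
      (L := logStar (2 * logHeight₁ x / H)) hΘlow hH1 hk2 (one_le_logStar _) ht
    linarith
  · have h1 := liouville_finite hne p hp
    have h2 := eg421_caseB_bound m hm1 (k := p / Real.log p)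
      (L := logStar (p * logHeight₁ x / H)) hΘlow hH1 (hkp p hp) (one_le_logStar _) ht
    linarith

end Literature.NumberTheory.DiophantineGeometry.Dioph

end
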